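import Summits.CriticalPhenomena.PercolationContinuityZ3.Theorems.Transplant.KNCells2ChainPlanar
import HarnessLib

/-!
# Corridor chains, the STRAIGHT RUN (Kozma–Nitzan's Lemma 11 as a planar schedule): from a small box `{|level| ≤ q, |trans| ≤ q'}` the start
# step onto the face `{level = q + s₁}` and then `N` advance steps of length `s₁`, all inside the prism `{-ρ ≤ level ≤ q + (N+1)s₁, |trans| ≤ ρ}`
# — the planar geometry of the ELONGATED deep routes (aspect `(N+1)s₁/ρ`) of the face step (`cond_of_step`) via `linkIn_of_chain`
# (design HOME/prim-bschramm-p2-g2/F8-DESIGN.md §9; Corridor-over-levels)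

builds on p205010 (kernel theorem, internal audit signed; external expert review pending) — nothing in this file uses p205010.
Lane `prim-bschramm`, seat `prim-bschramm-p2`; helper file (`--supports stmt-CriticalPhenomena-4575`).  Pure `Site 2` geometry.

Parameters `q q' s₁ ρ : ℤ`, `R' ℓ₀ N : ℕ` with `AdvOK`: `0 ≤ q`, `0 ≤ q'`, `R' + ℓ₀ ≤ s₁`, `2R' ≤ s₁`, `3q + s₁ + 2R' ≤ ρ`,
`q' + 2q + 2s₁ + (N + 3)R' ≤ ρ`.  `core 0 = {|level| ≤ q, |trans| ≤ q'}`, `core k = {level = q + k s₁, |trans| ≤ w₁ + (k-1)R'}` (`k ≥ 1`,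
`w₁ = q' + 2q + s₁ + 2R'`); `region 0 = {-ρ ≤ level ≤ q + s₁, |trans| ≤ ρ}`, `region k = {q + (k-2)s₁ ≤ level ≤ q + (k+1)s₁, |trans| ≤ ρ}`.
* `core_route` (`k ≤ N`), `enlarge_core_subset_region`, `core_succ_subset_region`, `region_subset_prism`, `core_nonempty`, `core_last`.
[cite: KozmaNitzan2024, §4 Lemma 11 (pp. 22–23)]
-/

noncomputable section

namespace Summit.CriticalPhenomena.PercolationContinuityZ3.Theorems

namespace Transplant

namespace ChainPlanar

namespace Adv

open Literature.Probability.Percolation Literature.Probability.LatticeModels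
open Literature.Probability.Percolation.KozmaNitzan
open Literature.Probability.Percolation.KozmaNitzan.Cells (oth oth_ne eq_oth_of_ne)

variable (q q' s₁ ρ : ℤ) (R' N : ℕ)

/-- The width of the first face. [folklore] -/
def w₁ : ℤ := q' + 2 * q + s₁ + 2 * R'

/-- Lower level of core `k`. [folklore] -/
def coreα (k : ℕ) : ℤ := if k = 0 then -q else q + (k : ℤ) * s₁

/-- Upper level of core `k`. [folklore] -/
def coreβ (k : ℕ) : ℤ := if k = 0 then q else q + (k : ℤ) * s₁

/-- Transverse half-width of core `k`. [folklore] -/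
def coreW (k : ℕ) : ℤ := if k = 0 then q' else w₁ q q' s₁ R' + ((k : ℤ) - 1) * R'

/-- **Core `k`** of the straight run (centre `c`, axis `a`, sign `σ`). [cite: KozmaNitzan2024, §4 Lemma 11 (p. 22)] -/
def core (a : Fin 2) (σ : ℤ) (c : Site 2) (k : ℕ) : Finset (Site 2) :=
  sBox a σ c (coreα q s₁ k) (coreβ q s₁ k) (coreW q q' s₁ R' k)

/-- **Region `k`** of the straight run. [cite: KozmaNitzan2024, §4 Lemma 11 (p. 22: the slabs of Ω)] -/
def region (a : Fin 2) (σ : ℤ) (c : Site 2) (k : ℕ) : Finset (Site 2) :=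
  if k = 0 then sBox a σ c (-ρ) (q + s₁) ρ else sBox a σ c (q + (k : ℤ) * s₁ - 2 * s₁) (q + (k : ℤ) * s₁ + s₁) ρ

/-- **Admissible parameters of a straight run.** [cite: KozmaNitzan2024, §4 Lemma 11 (p. 22)] -/
structure AdvOK (q q' s₁ ρ : ℤ) (R' ℓ₀ N : ℕ) : Prop where
  hq : 0 ≤ q
  hq' : 0 ≤ q'
  hs : (R' : ℤ) + ℓ₀ ≤ s₁
  hs2 : 2 * (R' : ℤ) ≤ s₁
  hρ0 : 3 * q + s₁ + 2 * R' ≤ ρ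
  hρ : q' + 2 * q + 2 * s₁ + ((N : ℤ) + 3) * R' ≤ ρ

variable {q q' s₁ R'} in
/-- Parameters of core `0` and of the faces. [folklore] -/
theorem core_params :
    (coreα q s₁ 0 = -q ∧ coreβ q s₁ 0 = q ∧ coreW q q' s₁ R' 0 = q') ∧
      ∀ k, 1 ≤ k → coreα q s₁ k = q + (k : ℤ) * s₁ ∧ coreβ q s₁ k = q + (k : ℤ) * s₁ ∧
        coreW q q' s₁ R' k = w₁ q q' s₁ R' + ((k : ℤ) - 1) * R' := by
  refine ⟨⟨by simp [coreα], by simp [coreβ], by simp [coreW]⟩, fun k hk => ?_⟩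
  have hk0 : k ≠ 0 := by omega
  exact ⟨by simp [coreα, hk0], by simp [coreβ, hk0], by simp [coreW, hk0]⟩

variable {q q' s₁ ρ R' N} {ℓ₀ : ℕ} {a : Fin 2} {σ : ℤ} (hσ : σ = 1 ∨ σ = -1) (c : Site 2) (h : AdvOK q q' s₁ ρ R' ℓ₀ N)
include hσ h

/-- **ROUTES** of the straight run: for `k ≤ N` and `v` in the `R'`-enlargement of `core k`, a square `v + Λ_ℓ ⊆ region k` with `ℓ ≥ ℓ₀`
and a quarter-face inside `core (k+1)`. [cite: KozmaNitzan2024, §4 Lemma 11 (pp. 22–23)] -/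
theorem core_route {k : ℕ} (hk : k ≤ N) {v : Site 2}
    (hv : v ∈ sBox a σ c (coreα q s₁ k - R') (coreβ q s₁ k + R') (coreW q q' s₁ R' k + R')) :
    ∃ ℓ : ℕ, ℓ₀ ≤ ℓ ∧ shiftF v (box 2 ℓ) ⊆ region q s₁ ρ a σ c k ∧
      ∃ τ : Fin 2 → ℤˣ, shiftF v (orthantFace a τ ℓ) ⊆ core q q' s₁ R' a σ c (k + 1) := by
  obtain ⟨⟨e0α, e0β, e0W⟩, eF⟩ := core_params (q := q) (q' := q') (s₁ := s₁) (R' := R')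
  have hq := h.hq; have hq' := h.hq'; have hs := h.hs; have hs2 := h.hs2; have hρ0 := h.hρ0; have hρ := h.hρ
  have hR0 : (0 : ℤ) ≤ R' := by positivity
  have hN0 : (0 : ℤ) ≤ N := by positivity
  have hNR : (0 : ℤ) ≤ (N : ℤ) * R' := by positivity
  by_cases hk0 : k = 0
  · subst hk0
    obtain ⟨e1α, e1β, e1W⟩ := eF 1 le_rfl
    rw [e0α, e0β, e0W] at hv
    obtain ⟨ℓ, hℓ0, -, -, hsq, τ, -, hface⟩ := route_start hσ c (q := q) (q' := q') (s := s₁) (w₁ := w₁ q q' s₁ R')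
      (ρ := ρ) (R' := R') (ℓ₀ := ℓ₀) hs (by unfold w₁; linarith) (by nlinarith) hρ0 hv
    refine ⟨ℓ, hℓ0, by rw [region, if_pos rfl]; exact hsq, τ, ?_⟩
    rw [core, e1α, e1β, e1W]
    convert hface using 2 <;> push_cast <;> ring
  · have hk1 : 1 ≤ k := by omega
    obtain ⟨eα, eβ, eW⟩ := eF k hk1
    obtain ⟨eα', eβ', eW'⟩ := eF (k + 1) (by omega)
    have hkR : ((k : ℤ) - 1) * R' ≤ ((N : ℤ) - 1) * R' :=
      mul_le_mul_of_nonneg_right (by linarith [(by exact_mod_cast hk : (k : ℤ) ≤ N)]) hR0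
    have hkR0 : 0 ≤ ((k : ℤ) - 1) * R' := mul_nonneg (by linarith [(by exact_mod_cast hk1 : (1 : ℤ) ≤ k)]) hR0
    rw [eα, eβ, eW] at hv
    obtain ⟨ℓ, hℓ0, -, -, hsq, τ, -, hface⟩ := route_advance hσ c (L := q + (k : ℤ) * s₁) (s := s₁)
      (w := w₁ q q' s₁ R' + ((k : ℤ) - 1) * R') (ρ := ρ) (R' := R') (ℓ₀ := ℓ₀) hs hs2 (by unfold w₁; linarith)
      (by unfold w₁; nlinarith) hv
    refine ⟨ℓ, hℓ0, by rw [region, if_neg hk0]; exact hsq, τ, ?_⟩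
    rw [core, eα', eβ', eW']
    convert hface using 2 <;> push_cast <;> ring

/-- **The `R'`-enlargement of core `k ≤ N` lies in region `k`.** [cite: KozmaNitzan2024, §4 Lemma 11 (p. 22)] -/
theorem enlarge_core_subset_region {k : ℕ} (hk : k ≤ N) :
    sBox a σ c (coreα q s₁ k - R') (coreβ q s₁ k + R') (coreW q q' s₁ R' k + R') ⊆ region q s₁ ρ a σ c k := by
  obtain ⟨⟨e0α, e0β, e0W⟩, eF⟩ := core_params (q := q) (q' := q') (s₁ := s₁) (R' := R')
  have hq := h.hq; have hq' := h.hq'; have hs := h.hs; have hs2 := h.hs2; have hρ0 := h.hρ0; have hρ := h.hρ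
  have hR0 : (0 : ℤ) ≤ R' := by positivity
  have hNR : (0 : ℤ) ≤ (N : ℤ) * R' := by positivity
  by_cases hk0 : k = 0
  · subst hk0
    rw [e0α, e0β, e0W, region, if_pos rfl]
    exact sBox_mono hσ c (by linarith) (by linarith) (by linarith)
  · have hk1 : 1 ≤ k := by omega
    obtain ⟨eα, eβ, eW⟩ := eF k hk1
    have hkR : ((k : ℤ) - 1) * R' ≤ ((N : ℤ) - 1) * R' :=
      mul_le_mul_of_nonneg_right (by linarith [(by exact_mod_cast hk : (k : ℤ) ≤ N)]) hR0
    rw [eα, eβ, eW, region, if_neg hk0]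
    exact sBox_mono hσ c (by linarith) (by linarith) (by unfold w₁; nlinarith)

/-- **The next core lies in region `k`** (`k ≤ N`). [cite: KozmaNitzan2024, §4 Lemma 11 (p. 22)] -/
theorem core_succ_subset_region {k : ℕ} (hk : k ≤ N) : core q q' s₁ R' a σ c (k + 1) ⊆ region q s₁ ρ a σ c k := by
  obtain ⟨-, eF⟩ := core_params (q := q) (q' := q') (s₁ := s₁) (R' := R')
  have hq := h.hq; have hq' := h.hq'; have hs := h.hs; have hs2 := h.hs2; have hρ0 := h.hρ0; have hρ := h.hρ
  have hR0 : (0 : ℤ) ≤ R' := by positivity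
  obtain ⟨eα, eβ, eW⟩ := eF (k + 1) (by omega)
  have hkR : (((k + 1 : ℕ) : ℤ) - 1) * R' ≤ (N : ℤ) * R' :=
    mul_le_mul_of_nonneg_right (by push_cast; linarith [(by exact_mod_cast hk : (k : ℤ) ≤ N)]) hR0
  have hkR0 : 0 ≤ (((k + 1 : ℕ) : ℤ) - 1) * R' := mul_nonneg (by push_cast; linarith [(Nat.cast_nonneg k : (0 : ℤ) ≤ k)]) hR0
  rw [core, eα, eβ, eW]
  by_cases hk0 : k = 0
  · subst hk0
    rw [region, if_pos rfl]
    push_cast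
    exact sBox_mono hσ c (by linarith) (by linarith) (by unfold w₁; linarith)
  · rw [region, if_neg hk0]
    push_cast
    exact sBox_mono hσ c (by nlinarith) (by linarith) (by unfold w₁; nlinarith)

/-- **All regions lie in the prism** `{-ρ ≤ level ≤ q + (N+1)s₁, |trans| ≤ ρ}`. [cite: KozmaNitzan2024, §4 Lemma 11 (p. 22: Ω)] -/
theorem region_subset_prism {k : ℕ} (hk : k ≤ N) :
    region q s₁ ρ a σ c k ⊆ sBox a σ c (-ρ) (q + ((N : ℤ) + 1) * s₁) ρ := by
  have hq := h.hq; have hs := h.hs; have hρ0 := h.hρ0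
  have hR0 : (0 : ℤ) ≤ R' := by positivity
  have hs0 : 0 ≤ s₁ := by linarith
  have hNs : (0 : ℤ) ≤ (N : ℤ) * s₁ := by positivity
  by_cases hk0 : k = 0
  · subst hk0; rw [region, if_pos rfl]
    exact sBox_mono hσ c le_rfl (by nlinarith) le_rfl
  · have hk1 : 1 ≤ k := by omega
    rw [region, if_neg hk0]
    have hks : (k : ℤ) * s₁ ≤ (N : ℤ) * s₁ := mul_le_mul_of_nonneg_right (by exact_mod_cast hk) hs0
    have hks1 : s₁ ≤ (k : ℤ) * s₁ := by
      have : (1 : ℤ) * s₁ ≤ (k : ℤ) * s₁ := mul_le_mul_of_nonneg_right (by exact_mod_cast hk1) hs0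
      linarith
    exact sBox_mono hσ c (by linarith) (by linarith) le_rfl

/-- **All cores are nonempty.** [folklore] -/
theorem core_nonempty (k : ℕ) : (core q q' s₁ R' a σ c k).Nonempty := by
  obtain ⟨⟨e0α, e0β, e0W⟩, eF⟩ := core_params (q := q) (q' := q') (s₁ := s₁) (R' := R')
  have hq := h.hq; have hq' := h.hq'; have hs := h.hs
  have hR0 : (0 : ℤ) ≤ R' := by positivity
  rw [core]
  by_cases hk0 : k = 0
  · subst hk0; rw [e0α, e0β, e0W]; exact sBox_nonempty hσ c (by linarith) hq'
  · obtain ⟨eα, eβ, eW⟩ := eF k (by omega)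
    have hkR0 : 0 ≤ ((k : ℤ) - 1) * R' := mul_nonneg (by linarith [(by exact_mod_cast (by omega : 1 ≤ k) : (1 : ℤ) ≤ k)]) hR0
    rw [eα, eβ, eW]; exact sBox_nonempty hσ c le_rfl (by unfold w₁; linarith)

omit hσ h in
/-- **The first core and the last core.** [folklore] -/
theorem core_zero_last :
    core q q' s₁ R' a σ c 0 = sBox a σ c (-q) q q' ∧
      core q q' s₁ R' a σ c (N + 1) = sBox a σ c (q + ((N : ℤ) + 1) * s₁) (q + ((N : ℤ) + 1) * s₁) (w₁ q q' s₁ R' + (N : ℤ) * R') := by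
  obtain ⟨⟨e0α, e0β, e0W⟩, eF⟩ := core_params (q := q) (q' := q') (s₁ := s₁) (R' := R')
  obtain ⟨eα, eβ, eW⟩ := eF (N + 1) (by omega)
  refine ⟨by rw [core, e0α, e0β, e0W], ?_⟩
  rw [core, eα, eβ, eW]; push_cast; ring_nf

end Adv

end ChainPlanar

end Transplant

end Summit.CriticalPhenomena.PercolationContinuityZ3.Theorems

end
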